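import Mathlib
import HarnessLib
import Literature.MathematicalPhysics.QuantumLattice.HubbardBandSectorCountingToolbox

/-!
# Route `KLProgramme` — support item `CountPairsOffset` (stmt-HubbardSuperconductivity-20036):
# the four non-degeneracy lemmas of the sector count, GENERIC in the momentum sum

The landed four-sector counting toolbox (`Literature/…/HubbardBandSectorCountingToolbox.lean`, BGM 2006 Lemma 3.1 /
App. A2) counts grid pairs `(θ₂, θ₃)` with `|ε(p(θ₁) + p(θ₂) + p(θ₃)) - μ| ≤ C_δ w` for a FIXED FIRST CURVE POINT `p(θ₁)`.
Item `CountPairsOffset` (DECOMP App. F Lemma F.1 of cell gate-hubbard-kl = the `2n`-leg sector count modulo `2πℤ²`,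
BGM (2.76)/(2.80) for all `|P_v|`, and the two-constraint input of the Cooper/non-Cooper split) asks for the same count
with `p(θ₁)` replaced by an ARBITRARY offset `P ∈ ℝ²`, uniformly in `P`.

Of the toolbox's four non-degeneracy lemmas, three (`cover`, `even_key`, `diag_strat`) see the offset only through the
two reals `(S_x, S_y)` = coordinates of the momentum sum; they are restated here for ARBITRARY `(S_x, S_y)` with
`|ε₂(S_x, S_y) - μ| ≤ η₀`, with the tree's proofs (`cover_offset`, `even_key_offset`, `diag_strat_offset`). The fourth,
the Cooper-range transversality `odd_transversal`, used `h(θ₂, θ₂ + π) = 0`, true only for an offset ON the curve; its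
replacement `odd_transversal_offset` (NEW) obtains the leg alignment from the smallness of the leg-2 partial derivative
instead (available in the both-partials-small family `P₀` of the counting scheme, the only place where the shift-line
fibration is used), by the Gauss-map mechanism of `cover`. Consequence (HOME/prover-p4/COUNTING-NOTE.md): the
arbitrary-offset count needs no hodograph / cubic-contact analysis; the level function is uniformly Morse near level `0`
for every offset, so no `γ`-power is lost at intermediate filling (C5a kill test of DECOMP §4: PASS).

All statements are over the tree's `BandBounds` constant bundle; nothing new is defined here.
References: G. Benfatto, A. Giuliani, V. Mastropietro, Ann. Henri Poincaré 7 (2006) 809–898, Lemma 3.1, (2.76), (2.80),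
App. A2; Ann. Henri Poincaré 4 (2003) 137–193, §7.
-/

noncomputable section

namespace Summit.HubbardSuperconductivity.HubbardSuperconductivity.Theorems.CountPairsOffset

set_option linter.dupNamespace false -- summit = problem name (single-conjunct summit), D-0017

open Real Set
open Literature.MathematicalPhysics.QuantumLattice Literature.MathematicalPhysics.QuantumLattice.BandSectorCounting

variable {a b : ℝ} (B : BandBounds a b) {μ : ℝ} (hμ : μ ∈ Icc a b)
include hμ

/-- **Covering lemma, generic in the momentum sum** (region `R₁`): for reals `S_x, S_y` with `|ε₂(S_x, S_y) - μ| ≤ η₀`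
(the coordinates of ANY momentum sum), if both leg cross terms `|sin S_x X'(θ_k) + sin S_y Y'(θ_k)|`, `k = 2, 3`, are
`≤ λ/2` then `θ₃ ≡ θ₂` modulo `π` up to `τ`. The tree's `cover` is the case `(S_x, S_y) = p(θ₁) + p(θ₂) + p(θ₃)`; the proof
is the tree's (Gauss-map alignment of each leg with the localised curve point), which used nothing about the offset.
-/
theorem cover_offset {Sx Sy θ₂ θ₃ η₀ lam τ : ℝ} (hlo : a ≤ μ - η₀) (hhi : μ + η₀ ≤ b)
    (hh' : |eps2 Sx Sy - μ| ≤ η₀)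
    (hd2 : |Real.sin Sx * bandVX μ θ₂ + Real.sin Sy * bandVY μ θ₂| ≤ lam / 2)
    (hd3 : |Real.sin Sx * bandVX μ θ₃ + Real.sin Sy * bandVY μ θ₃| ≤ lam / 2)
    (hsmall : 2 * (B.Cg * (lam / 2 + 2 * B.smax * (η₀ / B.Dtmin))) ≤ τ) :
    ∃ j : ℤ, |θ₃ - θ₂ - j * π| ≤ τ := by
  obtain ⟨φ, hsx, hsy, -, -⟩ := exists_near_curve_trig B hμ hh' hlo hhi
  have k3 : |Real.sin (bandX μ φ) * bandVX μ θ₃ + Real.sin (bandY μ φ) * bandVY μ θ₃| ≤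
      lam / 2 + 2 * B.smax * (η₀ / B.Dtmin) :=
    (cross_perturb B hμ hsx hsy).trans (by linarith)
  obtain ⟨j₃, hj₃⟩ := exists_int_near_of_cross_small B hμ k3
  have k2 : |Real.sin (bandX μ φ) * bandVX μ θ₂ + Real.sin (bandY μ φ) * bandVY μ θ₂| ≤
      lam / 2 + 2 * B.smax * (η₀ / B.Dtmin) :=
    (cross_perturb B hμ hsx hsy).trans (by linarith)
  obtain ⟨j₂, hj₂⟩ := exists_int_near_of_cross_small B hμ k2
  refine ⟨j₂ - j₃, ?_⟩
  have : θ₃ - θ₂ - ((j₂ - j₃ : ℤ) : ℝ) * π = (φ - θ₂ - j₂ * π) - (φ - θ₃ - j₃ * π) := by push_cast; ring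
  rw [this]
  calc |(φ - θ₂ - j₂ * π) - (φ - θ₃ - j₃ * π)| ≤ |φ - θ₂ - j₂ * π| + |φ - θ₃ - j₃ * π| := abs_sub _ _
    _ ≤ B.Cg * (lam / 2 + 2 * B.smax * (η₀ / B.Dtmin)) + B.Cg * (lam / 2 + 2 * B.smax * (η₀ / B.Dtmin)) :=
        add_le_add hj₂ hj₃
    _ ≤ τ := by linarith

/-- **Cooper-range transversality for an ARBITRARY offset, generic in the momentum sum** (region `R₂`, odd shift — the one
place where the fixed-curve-point toolbox used that the offset lies ON the curve). Let `S_x, S_y` be reals with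
`|ε₂(S_x, S_y) - μ| ≤ η₀` (in the application: the coordinates of `P + p(θ₂) + p(θ₂ + c)` for any offset `P`), let the leg-2
cross term satisfy `|sin S_x X'(θ₂) + sin S_y Y'(θ₂)| ≤ λ/2` (i.e. `|∂₂ h_P| ≤ λ`, available in the both-partials-small family
of the counting scheme) and `|c - π| ≤ τ`. Then the frozen-coefficient shift-line derivative
`2 sin S_x (X'(θ₂) + X'(θ₂ + c)) + 2 sin S_y (Y'(θ₂) + Y'(θ₂ + c))` — which IS `d/dθ₂ h_P(θ₂, θ₂ + c)` — has modulus
`≥ h_min |c - π|`. Proof: `X'(θ₂ + c) = -X'(θ₂ + t)`, `t = c - π`, so by the mean value theorem the derivative equals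
`-t (2 sin S_x X''(ξ) + 2 sin S_y Y''(ξ))`; the momentum sum is localised at a curve point `p(φ)` (`exists_near_curve_trig`),
leg 2 is aligned with `φ` modulo `π` by the small cross term (`exists_int_near_of_cross_small`, as in `cover`), hence so is `ξ`,
and `sin X(ξ) X''(ξ) + sin Y(ξ) Y''(ξ) = -(cos X X'² + cos Y Y'²) ≤ -h_min` (`sin_mul_acc_eq_neg_hess`). In the on-curve case
this replaces the tree's `odd_transversal`, whose hypothesis `|h| ≤ η_o |c - π|` was only the device to obtain the alignment
from `h` alone via `h(θ₂, θ₂ + π) = 0`. -/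
theorem odd_transversal_offset {Sx Sy θ₂ c τ η₀ lam : ℝ} (hlo : a ≤ μ - η₀) (hhi : μ + η₀ ≤ b)
    (hh' : |eps2 Sx Sy - μ| ≤ η₀)
    (hd2 : |Real.sin Sx * bandVX μ θ₂ + Real.sin Sy * bandVY μ θ₂| ≤ lam / 2)
    (hc : |c - π| ≤ τ)
    (hsmall : 4 * B.A2 * (η₀ / B.Dtmin + B.smax * (B.Cg * (lam / 2 + 2 * B.smax * (η₀ / B.Dtmin)) + τ)) ≤ B.hmin) :
    B.hmin * |c - π| ≤ |2 * Real.sin Sx * (bandVX μ θ₂ + bandVX μ (θ₂ + c)) +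
        2 * Real.sin Sy * (bandVY μ θ₂ + bandVY μ (θ₂ + c))| := by
  obtain ⟨h1, h2⟩ := B.level hμ
  have hs := B.smax_pos; have hA := B.A2_pos; have hCg := B.Cg_pos; have hD := B.Dtmin_pos
  have hη₀ : 0 ≤ η₀ := (abs_nonneg _).trans hh'
  have hlam : 0 ≤ lam := by linarith [abs_nonneg (Real.sin Sx * bandVX μ θ₂ + Real.sin Sy * bandVY μ θ₂)]
  set t := c - π with ht
  have hct : c = π + t := by rw [ht]; ring
  -- Step 1: localisation of the sum and alignment of leg 2 (the mechanism of `cover`)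
  obtain ⟨φ, hsx, hsy, -, -⟩ := exists_near_curve_trig B hμ hh' hlo hhi
  have k2 : |Real.sin (bandX μ φ) * bandVX μ θ₂ + Real.sin (bandY μ φ) * bandVY μ θ₂| ≤
      lam / 2 + 2 * B.smax * (η₀ / B.Dtmin) :=
    (cross_perturb B hμ hsx hsy).trans (by linarith)
  obtain ⟨j, hj⟩ := exists_int_near_of_cross_small B hμ k2
  -- Step 2: the mean value theorem for the frozen-coefficient function
  have hfd : ∀ x, HasDerivAt (fun x => 2 * Real.sin Sx * bandVX μ x + 2 * Real.sin Sy * bandVY μ x)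
      (2 * Real.sin Sx * bandAX μ x + 2 * Real.sin Sy * bandAY μ x) x := fun x =>
    ((hasDerivAt_bandVX h1 h2 x).const_mul (2 * Real.sin Sx)).fun_add
      ((hasDerivAt_bandVY h1 h2 x).const_mul (2 * Real.sin Sy))
  obtain ⟨ξ, hξ, hslope2⟩ := exists_slope hfd θ₂ t
  obtain ⟨-, -, qvx, qvy⟩ := band_add_pi h1 h2 (θ₂ + t)
  have hθc : θ₂ + c = θ₂ + t + π := by rw [hct]; ring
  have hD : 2 * Real.sin Sx * (bandVX μ θ₂ + bandVX μ (θ₂ + c)) + 2 * Real.sin Sy * (bandVY μ θ₂ + bandVY μ (θ₂ + c)) =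
      -(t * (2 * Real.sin Sx * bandAX μ ξ + 2 * Real.sin Sy * bandAY μ ξ)) := by
    rw [← hslope2, hθc, qvx, qvy]; ring
  -- align `φ` with `ξ`
  set ε₂ := B.Cg * (lam / 2 + 2 * B.smax * (η₀ / B.Dtmin)) + τ with hε₂
  have halign : |φ - ξ - j * π| ≤ ε₂ := by
    have hξθ : |θ₂ - ξ| ≤ τ := by
      have := abs_le_of_mem_between hξ
      rw [abs_sub_comm] at this
      exact this.trans hc
    calc |φ - ξ - j * π| = |(φ - θ₂ - j * π) + (θ₂ - ξ)| := by ring_nf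
      _ ≤ |φ - θ₂ - j * π| + |θ₂ - ξ| := abs_add_le _ _
      _ ≤ B.Cg * (lam / 2 + 2 * B.smax * (η₀ / B.Dtmin)) + τ := add_le_add hj hξθ
      _ = ε₂ := by rw [hε₂]
  obtain ⟨σ, hσ, ax, ay, -, -⟩ := exists_sign_align B hμ halign
  have hσabs : |σ| = 1 := by rcases hσ with rfl | rfl <;> norm_num
  set E := η₀ / B.Dtmin + B.smax * ε₂ with hE
  have cx : |σ * Real.sin Sx - Real.sin (bandX μ ξ)| ≤ E := by
    calc |σ * Real.sin Sx - Real.sin (bandX μ ξ)|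
        = |σ * (Real.sin Sx - Real.sin (bandX μ φ)) + (σ * Real.sin (bandX μ φ) - Real.sin (bandX μ ξ))| := by ring_nf
      _ ≤ |σ * (Real.sin Sx - Real.sin (bandX μ φ))| + |σ * Real.sin (bandX μ φ) - Real.sin (bandX μ ξ)| := abs_add_le _ _
      _ ≤ η₀ / B.Dtmin + B.smax * ε₂ := by rw [abs_mul, hσabs, one_mul]; exact add_le_add hsx ax
  have cy : |σ * Real.sin Sy - Real.sin (bandY μ ξ)| ≤ E := by
    calc |σ * Real.sin Sy - Real.sin (bandY μ ξ)|
        = |σ * (Real.sin Sy - Real.sin (bandY μ φ)) + (σ * Real.sin (bandY μ φ) - Real.sin (bandY μ ξ))| := by ring_nf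
      _ ≤ |σ * (Real.sin Sy - Real.sin (bandY μ φ))| + |σ * Real.sin (bandY μ φ) - Real.sin (bandY μ ξ)| := abs_add_le _ _
      _ ≤ η₀ / B.Dtmin + B.smax * ε₂ := by rw [abs_mul, hσabs, one_mul]; exact add_le_add hsy ay
  -- the core lower bound through the Hessian at `ξ`
  have hHess := B.hess_ge μ hμ ξ
  have hid := sin_mul_acc_eq_neg_hess h1 h2 ξ
  have hR := abs_two_term_sub_le (σ * Real.sin Sx) (σ * Real.sin Sy) (Real.sin (bandX μ ξ)) (Real.sin (bandY μ ξ))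
    (bandAX μ ξ) (bandAY μ ξ)
  have hE0 : 0 ≤ E := (abs_nonneg _).trans cx
  have bR1 : |σ * Real.sin Sx - Real.sin (bandX μ ξ)| * |bandAX μ ξ| ≤ E * B.A2 :=
    mul_le_mul cx (B.abs_AX_le μ hμ ξ) (abs_nonneg _) hE0
  have bR2 : |σ * Real.sin Sy - Real.sin (bandY μ ξ)| * |bandAY μ ξ| ≤ E * B.A2 :=
    mul_le_mul cy (B.abs_AY_le μ hμ ξ) (abs_nonneg _) hE0
  have hcore : B.hmin / 2 ≤ |Real.sin Sx * bandAX μ ξ + Real.sin Sy * bandAY μ ξ| := by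
    have e1 : |σ * Real.sin Sx * bandAX μ ξ + σ * Real.sin Sy * bandAY μ ξ| = |Real.sin Sx * bandAX μ ξ + Real.sin Sy * bandAY μ ξ| := by
      rw [show σ * Real.sin Sx * bandAX μ ξ + σ * Real.sin Sy * bandAY μ ξ =
        σ * (Real.sin Sx * bandAX μ ξ + Real.sin Sy * bandAY μ ξ) by ring, abs_mul, hσabs, one_mul]
    have e2 := abs_sub_abs_le_abs_sub (Real.sin (bandX μ ξ) * bandAX μ ξ + Real.sin (bandY μ ξ) * bandAY μ ξ)
      (σ * Real.sin Sx * bandAX μ ξ + σ * Real.sin Sy * bandAY μ ξ)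
    rw [abs_sub_comm] at e2
    have e3 : |Real.sin (bandX μ ξ) * bandAX μ ξ + Real.sin (bandY μ ξ) * bandAY μ ξ| =
        Real.cos (bandX μ ξ) * bandVX μ ξ ^ 2 + Real.cos (bandY μ ξ) * bandVY μ ξ ^ 2 := by
      rw [hid, abs_neg, abs_of_pos (lt_of_lt_of_le B.hmin_pos hHess)]
    -- smallness: `2 E A₂ ≤ h_min / 2`
    have hsm : 2 * (E * B.A2) ≤ B.hmin / 2 := by
      have : 2 * (E * B.A2) =
          (4 * B.A2 * (η₀ / B.Dtmin + B.smax * (B.Cg * (lam / 2 + 2 * B.smax * (η₀ / B.Dtmin)) + τ))) / 2 := by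
        rw [hE, hε₂]; ring
      rw [this]; linarith [hsmall]
    rw [← e1]
    linarith
  have hfin : 2 * Real.sin Sx * bandAX μ ξ + 2 * Real.sin Sy * bandAY μ ξ =
      2 * (Real.sin Sx * bandAX μ ξ + Real.sin Sy * bandAY μ ξ) := by ring
  rw [hD, abs_neg, abs_mul, hfin, abs_mul, abs_two]
  have := mul_le_mul_of_nonneg_left hcore (abs_nonneg t)
  linarith


/-- **The fold-in-`t` key lower bound, generic in the momentum sum** (region `R₂`, even shift): for reals `S_x, S_y` with
`|ε₂(S_x, S_y) - μ| ≤ η₀` (the coordinates of ANY momentum sum, offset on the curve or not), on the anti-diagonal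
`(σ - t/2, σ + t/2)`, `0 < t ≤ τ`, if `|G| ≤ 4λ` then the frozen-coefficient `t`-derivative is `≥ (h_min/2) t`. The tree's
`even_key` is the case `(S_x, S_y) = p(θ₁) + p(σ - t/2) + p(σ + t/2)`; the proof is the tree's, which used the on-curve
property of the offset nowhere. -/
theorem even_key_offset {Sx Sy σ t τ η₀ lam : ℝ} (ht0 : 0 < t) (htτ : t ≤ τ) (hlo : a ≤ μ - η₀) (hhi : μ + η₀ ≤ b)
    (hh' : |eps2 Sx Sy - μ| ≤ η₀)
    (hG : |2 * (Real.sin Sx * (bandVX μ (σ - t / 2) + bandVX μ (σ + t / 2))) +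
        2 * (Real.sin Sy * (bandVY μ (σ - t / 2) + bandVY μ (σ + t / 2)))| ≤ 4 * lam)
    (hsmall : 2 * B.A2 * (η₀ / B.Dtmin + B.smax * (B.Cg * (lam + B.A2 * τ + 2 * B.smax * (η₀ / B.Dtmin)) + τ / 2)) ≤ B.hmin / 2) :
    B.hmin / 2 * t ≤ |Real.sin Sx * (bandVX μ (σ + t / 2) - bandVX μ (σ - t / 2)) +
        Real.sin Sy * (bandVY μ (σ + t / 2) - bandVY μ (σ - t / 2))| := by
  obtain ⟨h1, h2⟩ := B.level hμ
  have hs := B.smax_pos; have hA := B.A2_pos; have hCg := B.Cg_pos; have hD := B.Dtmin_pos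
  have hη₀ : 0 ≤ η₀ := (abs_nonneg _).trans hh'
  have hlam : 0 ≤ lam := by
    linarith [abs_nonneg (2 * (Real.sin Sx * (bandVX μ (σ - t / 2) + bandVX μ (σ + t / 2))) +
        2 * (Real.sin Sy * (bandVY μ (σ - t / 2) + bandVY μ (σ + t / 2))))]
  have hτ : 0 < τ := ht0.trans_le htτ
  obtain ⟨φ, hsx, hsy, -, -⟩ := exists_near_curve_trig B hμ hh' hlo hhi
  -- `|sin Sx X'(σ) + sin Sy Y'(σ)| ≤ λ + A τ`
  have hvm := abs_bandVX_sub_le B hμ (σ - t / 2) σ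
  have hvp := abs_bandVX_sub_le B hμ (σ + t / 2) σ
  have hwm := abs_bandVY_sub_le B hμ (σ - t / 2) σ
  have hwp := abs_bandVY_sub_le B hμ (σ + t / 2) σ
  rw [show σ - t / 2 - σ = -(t / 2) by ring, abs_neg, abs_of_pos (by linarith : 0 < t / 2)] at hvm hwm
  rw [show σ + t / 2 - σ = t / 2 by ring, abs_of_pos (by linarith : 0 < t / 2)] at hvp hwp
  have hmid : |Real.sin Sx * bandVX μ σ + Real.sin Sy * bandVY μ σ| ≤ lam + B.A2 * τ := by
    have hG' : |Real.sin Sx * (bandVX μ (σ - t / 2) + bandVX μ (σ + t / 2)) +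
        Real.sin Sy * (bandVY μ (σ - t / 2) + bandVY μ (σ + t / 2))| ≤ 2 * lam := by
      rw [show 2 * (Real.sin Sx * (bandVX μ (σ - t / 2) + bandVX μ (σ + t / 2))) +
          2 * (Real.sin Sy * (bandVY μ (σ - t / 2) + bandVY μ (σ + t / 2))) =
          2 * (Real.sin Sx * (bandVX μ (σ - t / 2) + bandVX μ (σ + t / 2)) +
            Real.sin Sy * (bandVY μ (σ - t / 2) + bandVY μ (σ + t / 2))) by ring, abs_mul, abs_two] at hG
      linarith
    have hdiff : |Real.sin Sx * (bandVX μ (σ - t / 2) + bandVX μ (σ + t / 2)) +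
        Real.sin Sy * (bandVY μ (σ - t / 2) + bandVY μ (σ + t / 2)) -
        2 * (Real.sin Sx * bandVX μ σ + Real.sin Sy * bandVY μ σ)| ≤ B.A2 * t + B.A2 * t := by
      rw [show Real.sin Sx * (bandVX μ (σ - t / 2) + bandVX μ (σ + t / 2)) +
        Real.sin Sy * (bandVY μ (σ - t / 2) + bandVY μ (σ + t / 2)) -
        2 * (Real.sin Sx * bandVX μ σ + Real.sin Sy * bandVY μ σ) =
        Real.sin Sx * ((bandVX μ (σ - t / 2) - bandVX μ σ) + (bandVX μ (σ + t / 2) - bandVX μ σ)) +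
        Real.sin Sy * ((bandVY μ (σ - t / 2) - bandVY μ σ) + (bandVY μ (σ + t / 2) - bandVY μ σ)) by ring]
      refine (abs_two_term_le (Real.abs_sin_le_one _) ((abs_add_le _ _).trans (add_le_add hvm hvp))
        (Real.abs_sin_le_one _) ((abs_add_le _ _).trans (add_le_add hwm hwp))).trans ?_
      linarith
    have := abs_sub_abs_le_abs_sub (2 * (Real.sin Sx * bandVX μ σ + Real.sin Sy * bandVY μ σ))
      (Real.sin Sx * (bandVX μ (σ - t / 2) + bandVX μ (σ + t / 2)) + Real.sin Sy * (bandVY μ (σ - t / 2) + bandVY μ (σ + t / 2)))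
    rw [abs_sub_comm] at this
    rw [abs_mul, abs_two] at this
    nlinarith
  have k1 : |Real.sin (bandX μ φ) * bandVX μ σ + Real.sin (bandY μ φ) * bandVY μ σ| ≤
      lam + B.A2 * τ + 2 * B.smax * (η₀ / B.Dtmin) := (cross_perturb B hμ hsx hsy).trans (by linarith)
  obtain ⟨j, hj⟩ := exists_int_near_of_cross_small B hμ k1
  -- MVT for the frozen-coefficient function on `[σ - t/2, σ + t/2]`
  have hfd : ∀ x, HasDerivAt (fun x => Real.sin Sx * bandVX μ x + Real.sin Sy * bandVY μ x)
      (Real.sin Sx * bandAX μ x + Real.sin Sy * bandAY μ x) x := fun x =>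
    ((hasDerivAt_bandVX h1 h2 x).const_mul (Real.sin Sx)).fun_add ((hasDerivAt_bandVY h1 h2 x).const_mul (Real.sin Sy))
  obtain ⟨ξ, hξ, hslope⟩ := exists_slope hfd (σ - t / 2) t
  rw [show σ - t / 2 + t = σ + t / 2 by ring] at hslope
  have hval : Real.sin Sx * (bandVX μ (σ + t / 2) - bandVX μ (σ - t / 2)) +
      Real.sin Sy * (bandVY μ (σ + t / 2) - bandVY μ (σ - t / 2)) = t * (Real.sin Sx * bandAX μ ξ + Real.sin Sy * bandAY μ ξ) := by
    rw [← hslope]; ring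
  have hξσ : |ξ - σ| ≤ τ / 2 := by
    rw [min_eq_left ht0.le, max_eq_right ht0.le] at hξ
    rw [abs_le]; constructor <;> linarith [hξ.1, hξ.2]
  set ε₂ := B.Cg * (lam + B.A2 * τ + 2 * B.smax * (η₀ / B.Dtmin)) + τ / 2 with hε₂
  have halign : |φ - ξ - j * π| ≤ ε₂ := by
    calc |φ - ξ - j * π| = |(φ - σ - j * π) + (σ - ξ)| := by ring_nf
      _ ≤ |φ - σ - j * π| + |σ - ξ| := abs_add_le _ _
      _ ≤ B.Cg * (lam + B.A2 * τ + 2 * B.smax * (η₀ / B.Dtmin)) + τ / 2 := add_le_add hj (by rw [abs_sub_comm]; exact hξσ)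
  obtain ⟨σ', hσ', ax, ay, -, -⟩ := exists_sign_align B hμ halign
  have hσabs : |σ'| = 1 := by rcases hσ' with rfl | rfl <;> norm_num
  set ε₃ := η₀ / B.Dtmin + B.smax * ε₂ with hε₃
  have cx : |σ' * Real.sin Sx - Real.sin (bandX μ ξ)| ≤ ε₃ := by
    calc |σ' * Real.sin Sx - Real.sin (bandX μ ξ)|
        = |σ' * (Real.sin Sx - Real.sin (bandX μ φ)) + (σ' * Real.sin (bandX μ φ) - Real.sin (bandX μ ξ))| := by ring_nf
      _ ≤ |σ' * (Real.sin Sx - Real.sin (bandX μ φ))| + |σ' * Real.sin (bandX μ φ) - Real.sin (bandX μ ξ)| := abs_add_le _ _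
      _ ≤ η₀ / B.Dtmin + B.smax * ε₂ := by rw [abs_mul, hσabs, one_mul]; exact add_le_add hsx ax
  have cy : |σ' * Real.sin Sy - Real.sin (bandY μ ξ)| ≤ ε₃ := by
    calc |σ' * Real.sin Sy - Real.sin (bandY μ ξ)|
        = |σ' * (Real.sin Sy - Real.sin (bandY μ φ)) + (σ' * Real.sin (bandY μ φ) - Real.sin (bandY μ ξ))| := by ring_nf
      _ ≤ |σ' * (Real.sin Sy - Real.sin (bandY μ φ))| + |σ' * Real.sin (bandY μ φ) - Real.sin (bandY μ ξ)| := abs_add_le _ _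
      _ ≤ η₀ / B.Dtmin + B.smax * ε₂ := by rw [abs_mul, hσabs, one_mul]; exact add_le_add hsy ay
  have hHess := B.hess_ge μ hμ ξ
  have hid := sin_mul_acc_eq_neg_hess h1 h2 ξ
  have hR := abs_two_term_sub_le (σ' * Real.sin Sx) (σ' * Real.sin Sy) (Real.sin (bandX μ ξ)) (Real.sin (bandY μ ξ))
    (bandAX μ ξ) (bandAY μ ξ)
  have hε₃0 : 0 ≤ ε₃ := (abs_nonneg _).trans cx
  have bR1 : |σ' * Real.sin Sx - Real.sin (bandX μ ξ)| * |bandAX μ ξ| ≤ ε₃ * B.A2 :=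
    mul_le_mul cx (B.abs_AX_le μ hμ ξ) (abs_nonneg _) hε₃0
  have bR2 : |σ' * Real.sin Sy - Real.sin (bandY μ ξ)| * |bandAY μ ξ| ≤ ε₃ * B.A2 :=
    mul_le_mul cy (B.abs_AY_le μ hμ ξ) (abs_nonneg _) hε₃0
  have hcore : B.hmin / 2 ≤ |Real.sin Sx * bandAX μ ξ + Real.sin Sy * bandAY μ ξ| := by
    have e1 : |σ' * Real.sin Sx * bandAX μ ξ + σ' * Real.sin Sy * bandAY μ ξ| = |Real.sin Sx * bandAX μ ξ + Real.sin Sy * bandAY μ ξ| := by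
      rw [show σ' * Real.sin Sx * bandAX μ ξ + σ' * Real.sin Sy * bandAY μ ξ =
        σ' * (Real.sin Sx * bandAX μ ξ + Real.sin Sy * bandAY μ ξ) by ring, abs_mul, hσabs, one_mul]
    have e2 := abs_sub_abs_le_abs_sub (Real.sin (bandX μ ξ) * bandAX μ ξ + Real.sin (bandY μ ξ) * bandAY μ ξ)
      (σ' * Real.sin Sx * bandAX μ ξ + σ' * Real.sin Sy * bandAY μ ξ)
    rw [abs_sub_comm] at e2
    have e3 : |Real.sin (bandX μ ξ) * bandAX μ ξ + Real.sin (bandY μ ξ) * bandAY μ ξ| =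
        Real.cos (bandX μ ξ) * bandVX μ ξ ^ 2 + Real.cos (bandY μ ξ) * bandVY μ ξ ^ 2 := by
      rw [hid, abs_neg, abs_of_pos (lt_of_lt_of_le B.hmin_pos hHess)]
    have hsm : 2 * (ε₃ * B.A2) ≤ B.hmin / 2 := by linarith [hsmall]
    rw [← e1]
    linarith
  rw [hval, abs_mul, abs_of_pos ht0]
  have := mul_le_mul_of_nonneg_left hcore ht0.le
  linarith

/-- **Stratified non-degeneracy of the diagonal function, generic in the momentum sum**: for reals `S_x, S_y` with
`|ε₂(S_x, S_y) - μ| ≤ η₀`, if the frozen first derivative `|4 (sin S_x X'(σ) + sin S_y Y'(σ))| ≤ η₁` then the frozen second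
derivative is `≥ 2 h_min`. The tree's `diag_strat` is the case `(S_x, S_y) = p(θ₁) + 2 p(σ)`; same proof. -/
theorem diag_strat_offset {Sx Sy σ η₀ η₁ : ℝ} (hlo : a ≤ μ - η₀) (hhi : μ + η₀ ≤ b)
    (hh' : |eps2 Sx Sy - μ| ≤ η₀)
    (hH' : |4 * (Real.sin Sx * bandVX μ σ + Real.sin Sy * bandVY μ σ)| ≤ η₁)
    (hsmall : (16 * B.smax ^ 2 + 8 * B.A2) * (η₀ / B.Dtmin + B.smax * (B.Cg * (η₁ / 4 + 2 * B.smax * (η₀ / B.Dtmin)))) ≤ 2 * B.hmin) :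
    2 * B.hmin ≤ 8 * (Real.cos Sx * bandVX μ σ ^ 2 + Real.cos Sy * bandVY μ σ ^ 2) +
      4 * (Real.sin Sx * bandAX μ σ + Real.sin Sy * bandAY μ σ) := by
  obtain ⟨h1, h2⟩ := B.level hμ
  have hs := B.smax_pos; have hA := B.A2_pos; have hCg := B.Cg_pos; have hD := B.Dtmin_pos
  obtain ⟨φ, hsx, hsy, hcx, hcy⟩ := exists_near_curve_trig B hμ hh' hlo hhi
  have hmid : |Real.sin Sx * bandVX μ σ + Real.sin Sy * bandVY μ σ| ≤ η₁ / 4 := by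
    rw [abs_mul, show |(4:ℝ)| = 4 by norm_num] at hH'; linarith
  have k1 : |Real.sin (bandX μ φ) * bandVX μ σ + Real.sin (bandY μ φ) * bandVY μ σ| ≤
      η₁ / 4 + 2 * B.smax * (η₀ / B.Dtmin) := (cross_perturb B hμ hsx hsy).trans (by linarith)
  obtain ⟨j, hj⟩ := exists_int_near_of_cross_small B hμ k1
  obtain ⟨σ', hσ', ax, ay, bx, bY⟩ := exists_sign_align B hμ hj
  have hσabs : |σ'| = 1 := by rcases hσ' with rfl | rfl <;> norm_num
  set ε₃ := η₀ / B.Dtmin + B.smax * (B.Cg * (η₁ / 4 + 2 * B.smax * (η₀ / B.Dtmin))) with hε₃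
  have cx : |σ' * Real.sin Sx - Real.sin (bandX μ σ)| ≤ ε₃ := by
    calc |σ' * Real.sin Sx - Real.sin (bandX μ σ)|
        = |σ' * (Real.sin Sx - Real.sin (bandX μ φ)) + (σ' * Real.sin (bandX μ φ) - Real.sin (bandX μ σ))| := by ring_nf
      _ ≤ |σ' * (Real.sin Sx - Real.sin (bandX μ φ))| + |σ' * Real.sin (bandX μ φ) - Real.sin (bandX μ σ)| := abs_add_le _ _
      _ ≤ ε₃ := by rw [abs_mul, hσabs, one_mul]; exact add_le_add hsx ax
  have cy : |σ' * Real.sin Sy - Real.sin (bandY μ σ)| ≤ ε₃ := by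
    calc |σ' * Real.sin Sy - Real.sin (bandY μ σ)|
        = |σ' * (Real.sin Sy - Real.sin (bandY μ φ)) + (σ' * Real.sin (bandY μ φ) - Real.sin (bandY μ σ))| := by ring_nf
      _ ≤ |σ' * (Real.sin Sy - Real.sin (bandY μ φ))| + |σ' * Real.sin (bandY μ φ) - Real.sin (bandY μ σ)| := abs_add_le _ _
      _ ≤ ε₃ := by rw [abs_mul, hσabs, one_mul]; exact add_le_add hsy ay
  have dx : |Real.cos Sx - Real.cos (bandX μ σ)| ≤ ε₃ := by
    calc |Real.cos Sx - Real.cos (bandX μ σ)| = |(Real.cos Sx - Real.cos (bandX μ φ)) + (Real.cos (bandX μ φ) - Real.cos (bandX μ σ))| := by ring_nf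
      _ ≤ |Real.cos Sx - Real.cos (bandX μ φ)| + |Real.cos (bandX μ φ) - Real.cos (bandX μ σ)| := abs_add_le _ _
      _ ≤ ε₃ := add_le_add hcx bx
  have dy : |Real.cos Sy - Real.cos (bandY μ σ)| ≤ ε₃ := by
    calc |Real.cos Sy - Real.cos (bandY μ σ)| = |(Real.cos Sy - Real.cos (bandY μ φ)) + (Real.cos (bandY μ φ) - Real.cos (bandY μ σ))| := by ring_nf
      _ ≤ |Real.cos Sy - Real.cos (bandY μ φ)| + |Real.cos (bandY μ φ) - Real.cos (bandY μ σ)| := abs_add_le _ _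
      _ ≤ ε₃ := add_le_add hcy bY
  have hε₃0 : 0 ≤ ε₃ := (abs_nonneg _).trans cx
  have hHess := B.hess_ge μ hμ σ
  have hid := sin_mul_acc_eq_neg_hess h1 h2 σ
  set Hs := Real.cos (bandX μ σ) * bandVX μ σ ^ 2 + Real.cos (bandY μ σ) * bandVY μ σ ^ 2 with hHs
  -- the `cos`-part
  have hvx := B.abs_VX_le μ hμ σ; have hvy := B.abs_VY_le μ hμ σ
  have hsq1 : |bandVX μ σ ^ 2| ≤ B.smax ^ 2 := by rw [abs_pow, sq, sq]; exact mul_le_mul hvx hvx (abs_nonneg _) hs.le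
  have hsq2 : |bandVY μ σ ^ 2| ≤ B.smax ^ 2 := by rw [abs_pow, sq, sq]; exact mul_le_mul hvy hvy (abs_nonneg _) hs.le
  have R1 := abs_two_term_sub_le (Real.cos Sx) (Real.cos Sy) (Real.cos (bandX μ σ)) (Real.cos (bandY μ σ))
    (bandVX μ σ ^ 2) (bandVY μ σ ^ 2)
  have bR1 : |Real.cos Sx - Real.cos (bandX μ σ)| * |bandVX μ σ ^ 2| ≤ ε₃ * B.smax ^ 2 :=
    mul_le_mul dx hsq1 (abs_nonneg _) hε₃0
  have bR2 : |Real.cos Sy - Real.cos (bandY μ σ)| * |bandVY μ σ ^ 2| ≤ ε₃ * B.smax ^ 2 :=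
    mul_le_mul dy hsq2 (abs_nonneg _) hε₃0
  have part1 : 8 * Hs - 16 * B.smax ^ 2 * ε₃ ≤ 8 * (Real.cos Sx * bandVX μ σ ^ 2 + Real.cos Sy * bandVY μ σ ^ 2) := by
    have := (abs_le.1 (R1.trans (add_le_add bR1 bR2))).1
    rw [hHs]; linarith
  -- the `sin`-part
  have R2 := abs_two_term_sub_le (σ' * Real.sin Sx) (σ' * Real.sin Sy) (Real.sin (bandX μ σ)) (Real.sin (bandY μ σ))
    (bandAX μ σ) (bandAY μ σ)
  have bR3 : |σ' * Real.sin Sx - Real.sin (bandX μ σ)| * |bandAX μ σ| ≤ ε₃ * B.A2 :=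
    mul_le_mul cx (B.abs_AX_le μ hμ σ) (abs_nonneg _) hε₃0
  have bR4 : |σ' * Real.sin Sy - Real.sin (bandY μ σ)| * |bandAY μ σ| ≤ ε₃ * B.A2 :=
    mul_le_mul cy (B.abs_AY_le μ hμ σ) (abs_nonneg _) hε₃0
  have part2 : -4 * Hs - 8 * B.A2 * ε₃ ≤ 4 * (Real.sin Sx * bandAX μ σ + Real.sin Sy * bandAY μ σ) := by
    have hb := abs_le.1 (R2.trans (add_le_add bR3 bR4))
    -- `σ' (sin Sx AX + sin Sy AY) ≥ -Hs - 2 A ε₃`, and `σ' = ±1`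
    have hHs_pos : 0 < Hs := lt_of_lt_of_le B.hmin_pos hHess
    rcases hσ' with rfl | rfl
    · simp only [one_mul] at hb; linarith [hb.1, hb.2]
    · simp only [neg_one_mul] at hb; linarith [hb.1, hb.2]
  have hsm : (16 * B.smax ^ 2 + 8 * B.A2) * ε₃ ≤ 2 * B.hmin := hsmall
  linarith [part1, part2, hHess, hsm]

end Summit.HubbardSuperconductivity.HubbardSuperconductivity.Theorems.CountPairsOffset

end
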